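import Summits.QuantumFields.BalabanUV.T4Continuum.Support.NE3SliceOrthogonality
import HarnessLib

/-!
# NE3FlatHodgeSplit (T⁴ programme, node NE3, row NE3-R2; row H1 of the owner's ruling ρ-g21-4) — THE FLAT LANDAU∕HODGE SPLIT ON THE
# PERIODIC LATTICE: the discrete Poisson equation on the torus is solvable for mean-zero data, hence every periodic 1-form is
# `Y = η + dPot ζ` with `η` CO-CLOSED (`Σ_κ (η x κ − η (x−e_κ) κ) = 0` at every site) and `ζ` periodic; `η ⊥ dPot ξ` and Pythagoras

HONEST FRAMING (cell `pub-balaban`, T4-DAG PAGE 1; unit `b2b-balaban-t4-ne3r2-p1` = owner of BINDER-OWNERS row NE3-R2, gen 6; rulings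
ρ-g21-3∕ρ-g21-4: the located inequality of (ML_w) is the curl-currency Poincaré (P♮) on the chart's slice, flat route = HODGE∕LANDAU SPLIT —
F-ne3p1-g21-1 §2 ≡ F-ne3r2-g6-2 §D).  The cell's T4 target is the finite-torus continuum limit of the unit-scale averaged loop expectations —
NOT infinite volume, NO mass gap, NOT Clay, NOT summit progress.  THIS FILE is row H1 (kinematics of the flat periodic lattice; all
[folklore], 0 sorry, complex values):
§1 the finite torus `TorSite d P = Fin d → ZMod P`: the lattice Laplacian `torLap`, `Σ_t torLap u t = 0`, the ENERGY IDENTITY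
   `Σ_t Σ_μ ‖u(t+e_μ) − u t‖² = −Σ_t ⟪u t, torLap u t⟫_ℝ`, `torLap u = 0 ⇒ u constant` (the torus is connected by unit steps), and by
   rank–nullity **`exists_torLap_eq`**: `Σ_t f t = 0 ⇒ ∃ u, torLap u = f`;
§2 the bridge to the crew's periodic functions on `Site d = ℤ^d` (`toTor`, `liftTor`, `periodic_vec'`, `sum_liftTor_eq_sum_periodBox`) and
   **`exists_periodic_lap_eq`**: for `P ≥ 1`, a `P`-periodic `f : Site d → ℂ` with `Σ_{x∈periodBox P} f x = 0` is `Σ_μ (ζ(x+e_μ) − 2ζ x + ζ(x−e_μ))`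
   for some `P`-periodic `ζ`;
§3 THE SPLIT **`exists_flatHodgeSplit`**: every `P`-periodic `Y : Site d → Fin d → ℂ` is `Y = η + dPot ζ` with `ζ` `P`-periodic and
   `Σ_κ (η x κ − η (x − e_κ) κ) = 0` for EVERY `x` (the divergence of a periodic form has zero period sum; the divergence of `dPot ζ` is the
   Laplacian of `ζ`); the ORTHOGONALITY `Σ_{x∈periodBox P} Σ_κ ⟪dPot ξ x κ, η x κ⟫_ℝ = 0` for periodic `ξ` is the owner's
   `NE3SliceOrthogonality.sum_inner_dPot_eq_neg_sum_inner_flatDiv` BY NAME (`sum_inner_dPot_eq_zero_of_coclosed`), whence PYTHAGORAS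
   `Σ‖Y‖² = Σ‖η‖² + Σ‖dPot ζ‖²` over the period box (`sum_norm_sq_eq_of_split`).
Nothing about Bałaban's minimisers, (P♮) at `W ≠ 1`, (ML_w), T-E_w or NE3 is asserted; NE3 NOT proved; spine 0∕9; rung (B)+1.  ABSOLUTE RULE
kept: no printed sentence is a hypothesis (context: [Balaban1984PropagatorsI] (1.20)–(1.21) p. 20).  PLACEMENT: `Summits/QuantumFields/BalabanUV/`;
imports the owner's `NE3SliceOrthogonality` (hence (70S)) BY NAME; moves nothing.
-/

set_option autoImplicit false

open scoped BigOperators InnerProductSpace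
open Finset

namespace Summit.QuantumFields.BalabanUV.T4Continuum.NE3FlatHodgeSplit

open Literature.MathematicalPhysics.QuantumFieldTheory.Balaban1983to89
open B7Prop1Explicit
open T4AveragingDeficitWallBoundary (periodBox mem_periodBox)
open NE3TangentNoGoWords (dPot)
open NE3CoarseTorusExact (sum_periodBox_add_e)
open NE3SliceOrthogonality (sum_inner_dPot_eq_neg_sum_inner_flatDiv)

noncomputable section

/-! ## §1 The discrete Poisson equation on the finite torus -/

section Torus

variable {d P : ℕ} [NeZero P]

/-- The finite torus `(ℤ∕Pℤ)^d`. [folklore] -/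
abbrev TorSite (d P : ℕ) : Type := Fin d → ZMod P

/-- The unit vector `e_μ` on the finite torus. [folklore] -/
def te (μ : Fin d) : TorSite d P := Pi.single μ 1

/-- THE LATTICE LAPLACIAN on the finite torus: `Σ_μ (u(t+e_μ) − 2u(t) + u(t−e_μ))`. [folklore] -/
def torLap (u : TorSite d P → ℂ) (t : TorSite d P) : ℂ :=
  ∑ μ : Fin d, (u (t + te μ) - 2 * u t + u (t - te μ))

/-- The Laplacian as a linear map. [folklore] -/
def torLapL : (TorSite d P → ℂ) →ₗ[ℂ] (TorSite d P → ℂ) where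
  toFun := torLap
  map_add' u v := by
    funext t
    simp only [torLap, Pi.add_apply, ← Finset.sum_add_distrib]
    exact Finset.sum_congr rfl fun _ _ => by ring
  map_smul' c u := by
    funext t
    simp only [torLap, Pi.smul_apply, smul_eq_mul, RingHom.id_apply, Finset.mul_sum]
    exact Finset.sum_congr rfl fun _ _ => by ring

omit [NeZero P] in
/-- `torLapL u = torLap u`. [folklore] -/
@[simp] theorem torLapL_apply (u : TorSite d P → ℂ) : torLapL u = torLap u := rfl

/-- Translated sums over the torus are unchanged. [folklore] -/
theorem sum_shift (g : TorSite d P → ℂ) (v : TorSite d P) : ∑ t, g (t + v) = ∑ t, g t :=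
  Fintype.sum_equiv (Equiv.addRight v) _ _ fun _ => rfl

/-- The Laplacian has zero sum over the torus. [folklore] -/
theorem sum_torLap (u : TorSite d P → ℂ) : ∑ t, torLap u t = 0 := by
  simp only [torLap]
  rw [Finset.sum_comm]
  refine Finset.sum_eq_zero fun μ _ => ?_
  have h1 : ∑ t, u (t + te μ) = ∑ t, u t := sum_shift u (te μ)
  have h2 : ∑ t, u (t - te μ) = ∑ t, u t := by
    simpa [sub_eq_add_neg] using sum_shift u (-(te μ))
  simp only [Finset.sum_add_distrib, Finset.sum_sub_distrib, h1, h2, ← Finset.mul_sum]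
  ring

/-- Translated real sums over the torus are unchanged. [folklore] -/
theorem sum_shift_real (g : TorSite d P → ℝ) (v : TorSite d P) : ∑ t, g (t + v) = ∑ t, g t :=
  Fintype.sum_equiv (Equiv.addRight v) _ _ fun _ => rfl

/-- **THE ENERGY IDENTITY**: `Σ_t Σ_μ ‖u(t+e_μ) − u t‖² = −Σ_t ⟪u t, torLap u t⟫_ℝ`. [folklore] -/
theorem energy_identity (u : TorSite d P → ℂ) :
    ∑ t, ∑ μ : Fin d, ‖u (t + te μ) - u t‖ ^ 2 = -∑ t, ⟪u t, torLap u t⟫_ℝ := by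
  have hμ : ∀ μ : Fin d, ∑ t, ‖u (t + te μ) - u t‖ ^ 2
      = -∑ t, ⟪u t, u (t + te μ) - 2 * u t + u (t - te μ)⟫_ℝ := by
    intro μ
    have h1 : ∑ t, ‖u (t + te μ)‖ ^ 2 = ∑ t, ‖u t‖ ^ 2 := sum_shift_real (fun t => ‖u t‖ ^ 2) (te μ)
    have h2 : ∑ t, ⟪u t, u (t - te μ)⟫_ℝ = ∑ t, ⟪u (t + te μ), u t⟫_ℝ := by
      rw [← sum_shift_real (fun t => ⟪u t, u (t - te μ)⟫_ℝ) (te μ)]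
      simp only [add_sub_cancel_right]
    have h3 : ∀ t, ⟪u t, (2 : ℂ) * u t⟫_ℝ = 2 * ‖u t‖ ^ 2 := by
      intro t
      rw [show (2 : ℂ) * u t = (2 : ℝ) • u t by simp [two_smul, two_mul], real_inner_smul_right,
        real_inner_self_eq_norm_sq]
    have hc : ∀ t, ⟪u t, u (t + te μ)⟫_ℝ = ⟪u (t + te μ), u t⟫_ℝ := fun t => real_inner_comm _ _
    have hL : ∑ t, ‖u (t + te μ) - u t‖ ^ 2 = 2 * ∑ t, ‖u t‖ ^ 2 - 2 * ∑ t, ⟪u (t + te μ), u t⟫_ℝ := by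
      simp only [norm_sub_sq_real, Finset.sum_add_distrib, Finset.sum_sub_distrib, h1, ← Finset.mul_sum]
      ring
    have hR : ∑ t, ⟪u t, u (t + te μ) - 2 * u t + u (t - te μ)⟫_ℝ
        = 2 * ∑ t, ⟪u (t + te μ), u t⟫_ℝ - 2 * ∑ t, ‖u t‖ ^ 2 := by
      simp only [inner_add_right, inner_sub_right, h3, hc, Finset.sum_add_distrib, Finset.sum_sub_distrib, h2,
        ← Finset.mul_sum]
      ring
    rw [hL, hR]
    ring
  calc ∑ t, ∑ μ : Fin d, ‖u (t + te μ) - u t‖ ^ 2 = ∑ μ : Fin d, ∑ t, ‖u (t + te μ) - u t‖ ^ 2 := Finset.sum_comm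
    _ = ∑ μ : Fin d, -∑ t, ⟪u t, u (t + te μ) - 2 * u t + u (t - te μ)⟫_ℝ := Finset.sum_congr rfl fun μ _ => hμ μ
    _ = -∑ t, ⟪u t, torLap u t⟫_ℝ := by
        rw [Finset.sum_neg_distrib, Finset.sum_comm]
        simp only [torLap, inner_sum]

/-- Every torus site is the sum of its coordinates times the unit vectors. [folklore] -/
theorem eq_sum_val_smul_te (t : TorSite d P) : t = ∑ μ : Fin d, ((t μ).val : ℕ) • (te μ : TorSite d P) := by
  have h : ∀ μ : Fin d, ((t μ).val : ℕ) • (te μ : TorSite d P) = Pi.single μ (t μ) := by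
    intro μ
    rw [te, ← Pi.single_smul', nsmul_eq_mul, mul_one, ZMod.natCast_zmod_val]
  simp only [h]
  exact (Finset.univ_sum_single t).symm

/-- **A HARMONIC FUNCTION ON THE TORUS IS CONSTANT** (energy identity + connectedness by unit steps). [folklore] -/
theorem const_of_torLap_eq_zero (u : TorSite d P → ℂ) (h : torLap u = 0) (t : TorSite d P) : u t = u 0 := by
  have hE : ∑ s, ∑ μ : Fin d, ‖u (s + te μ) - u s‖ ^ 2 = 0 := by
    rw [energy_identity]; simp [h]
  have hstep : ∀ (s : TorSite d P) (μ : Fin d), u (s + te μ) = u s := by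
    intro s μ
    have h1 : ∑ μ' : Fin d, ‖u (s + te μ') - u s‖ ^ 2 = 0 :=
      (Finset.sum_eq_zero_iff_of_nonneg fun _ _ => by positivity).mp hE s (Finset.mem_univ _)
    have h2 : ‖u (s + te μ) - u s‖ ^ 2 = 0 :=
      (Finset.sum_eq_zero_iff_of_nonneg fun _ _ => by positivity).mp h1 μ (Finset.mem_univ _)
    exact sub_eq_zero.mp (norm_eq_zero.mp (pow_eq_zero_iff two_ne_zero |>.mp h2))
  have hn : ∀ (s : TorSite d P) (μ : Fin d) (n : ℕ), u (s + n • te μ) = u s := by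
    intro s μ n
    induction n with
    | zero => simp
    | succ n ih => rw [add_smul, one_smul, ← add_assoc, hstep, ih]
  have key : ∀ (S : Finset (Fin d)) (s : TorSite d P), u (s + ∑ μ ∈ S, ((t μ).val : ℕ) • (te μ : TorSite d P)) = u s := by
    intro S
    induction S using Finset.induction_on with
    | empty => intro s; simp
    | insert μ S hμ ih => intro s; rw [Finset.sum_insert hμ, add_comm (_ • _), ← add_assoc, hn, ih]
  have := key Finset.univ 0
  rw [zero_add, ← eq_sum_val_smul_te] at this
  exact this

/-- The kernel of the Laplacian is the line of constants. [folklore] -/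
theorem ker_torLapL : LinearMap.ker (torLapL (d := d) (P := P)) = Submodule.span ℂ {fun _ => (1 : ℂ)} := by
  ext u
  rw [LinearMap.mem_ker, Submodule.mem_span_singleton, torLapL_apply]
  constructor
  · intro h
    refine ⟨u 0, ?_⟩
    funext t
    simp [const_of_torLap_eq_zero u h t]
  · rintro ⟨a, rfl⟩
    funext t
    simp only [torLap, Pi.smul_apply, smul_eq_mul, mul_one, Pi.zero_apply]
    simp only [Finset.sum_const, Finset.card_univ, Fintype.card_fin, nsmul_eq_mul]
    ring

/-- The «total sum» functional. [folklore] -/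
def sumL : (TorSite d P → ℂ) →ₗ[ℂ] ℂ where
  toFun f := ∑ t, f t
  map_add' f g := by simp [Finset.sum_add_distrib]
  map_smul' c f := by simp [Finset.mul_sum]

/-- **THE DISCRETE POISSON EQUATION ON THE TORUS IS SOLVABLE FOR MEAN-ZERO DATA** (rank–nullity: the range of the Laplacian and the
mean-zero functions have the same dimension `P^d − 1`, and the former lies in the latter). [folklore] -/
theorem exists_torLap_eq (f : TorSite d P → ℂ) (hf : ∑ t, f t = 0) : ∃ u : TorSite d P → ℂ, torLap u = f := by
  have hle : LinearMap.range (torLapL (d := d) (P := P)) ≤ LinearMap.ker (sumL (d := d) (P := P)) := by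
    rintro g ⟨u, rfl⟩
    rw [LinearMap.mem_ker]
    show ∑ t, torLapL u t = 0
    simp only [torLapL_apply]
    exact sum_torLap u
  have hcard : Module.finrank ℂ (TorSite d P → ℂ) = Fintype.card (TorSite d P) := Module.finrank_fintype_fun_eq_card _
  have hker : Module.finrank ℂ (LinearMap.ker (torLapL (d := d) (P := P))) = 1 := by
    rw [ker_torLapL]
    exact finrank_span_singleton (by intro h; simpa using congr_fun h 0)
  have hsum_range : LinearMap.range (sumL (d := d) (P := P)) = ⊤ := by
    rw [LinearMap.range_eq_top]
    intro c
    refine ⟨Pi.single 0 c, ?_⟩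
    simp [sumL]
  have h1 := LinearMap.finrank_range_add_finrank_ker (torLapL (d := d) (P := P))
  have h2 := LinearMap.finrank_range_add_finrank_ker (sumL (d := d) (P := P))
  rw [hsum_range, finrank_top, Module.finrank_self] at h2
  have heq : Module.finrank ℂ (LinearMap.range (torLapL (d := d) (P := P)))
      = Module.finrank ℂ (LinearMap.ker (sumL (d := d) (P := P))) := by omega
  have hEq := Submodule.eq_of_le_of_finrank_eq hle heq
  have hf' : f ∈ LinearMap.ker (sumL (d := d) (P := P)) := by simpa [sumL, LinearMap.mem_ker] using hf
  rw [← hEq] at hf'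
  obtain ⟨u, hu⟩ := hf'
  exact ⟨u, hu⟩

end Torus

/-! ## §2 The bridge to periodic functions on `ℤ^d` -/

section Bridge

variable {d P : ℕ} [NeZero P]

/-- Reduction modulo `P` of a lattice site. [folklore] -/
def toTor (P : ℕ) (x : Site d) : TorSite d P := fun i => ((x i : ℤ) : ZMod P)

/-- The standard representative in `[0,P)^d` of a torus site. [folklore] -/
def liftTor (t : TorSite d P) : Site d := fun i => ((t i).val : ℤ)

omit [NeZero P] in
/-- `toTor` of a unit step. [folklore] -/
theorem toTor_add_e (x : Site d) (μ : Fin d) : toTor P (x + e μ) = toTor P x + te μ := by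
  funext i
  by_cases h : i = μ
  · subst h; simp [toTor, te, e_apply]
  · simp [toTor, te, e_apply, h]

omit [NeZero P] in
/-- `toTor` of a backward unit step. [folklore] -/
theorem toTor_sub_e (x : Site d) (μ : Fin d) : toTor P (x - e μ) = toTor P x - te μ := by
  have h := toTor_add_e (P := P) (x - e μ) μ
  rw [sub_add_cancel] at h
  rw [h, add_sub_cancel_right]

omit [NeZero P] in
/-- `toTor` is `P`-periodic. [folklore] -/
theorem toTor_add_period (x : Site d) (τ : Fin d) : toTor P (x + (P : ℤ) • e τ) = toTor P x := by
  funext i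
  simp [toTor, e_apply]

/-- `toTor ∘ liftTor = id`. [folklore] -/
theorem toTor_liftTor (t : TorSite d P) : toTor P (liftTor t) = t := by
  funext i
  simp [toTor, liftTor]

omit [NeZero P] in
/-- Single-direction periodicity extends to integer multiples of the period. [folklore] -/
theorem periodic_zmul' {X : Type*} {g : Site d → X} (hg : ∀ (x : Site d) (τ : Fin d), g (x + (P : ℤ) • e τ) = g x)
    (x : Site d) (τ : Fin d) (m : ℤ) : g (x + (m * (P : ℤ)) • e τ) = g x := by
  induction m using Int.induction_on generalizing x with
  | zero => simp
  | succ m ih => rw [add_mul, one_mul, add_smul, ← add_assoc, hg, ih]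
  | pred m ih =>
      have h1 := hg (x + ((-(m : ℤ) - 1) * (P : ℤ)) • e τ) τ
      rw [add_assoc, ← add_smul, show (-(m : ℤ) - 1) * (P : ℤ) + (P : ℤ) = -(m : ℤ) * P by ring] at h1
      rw [← h1, ih]

omit [NeZero P] in
/-- … and to every period vector: `g (x + P•q) = g x`. [folklore] -/
theorem periodic_vec' {X : Type*} {g : Site d → X} (hg : ∀ (x : Site d) (τ : Fin d), g (x + (P : ℤ) • e τ) = g x)
    (x q : Site d) : g (x + (P : ℤ) • q) = g x := by
  have key : ∀ (S : Finset (Fin d)) (x : Site d), g (x + ∑ τ ∈ S, (q τ * (P : ℤ)) • e τ) = g x := by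
    intro S
    induction S using Finset.induction_on with
    | empty => intro x; simp
    | insert τ S hτ ih => intro x; rw [Finset.sum_insert hτ, add_comm (_ • _), ← add_assoc, periodic_zmul' hg, ih]
  have hq : (P : ℤ) • q = ∑ τ : Fin d, (q τ * (P : ℤ)) • e τ := by
    funext i
    simp only [Pi.smul_apply, smul_eq_mul, Finset.sum_apply, e_apply, mul_ite, mul_one, mul_zero, Finset.sum_ite_eq,
      Finset.mem_univ, if_true]
    ring
  rw [hq]
  exact key Finset.univ x

/-- A lattice site is its standard representative plus a period vector. [folklore] -/
theorem eq_liftTor_toTor_add (x : Site d) : ∃ q : Site d, x = liftTor (toTor P x) + (P : ℤ) • q := by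
  refine ⟨fun i => x i / (P : ℤ), ?_⟩
  funext i
  simp only [liftTor, toTor, Pi.add_apply, Pi.smul_apply, smul_eq_mul, ZMod.val_intCast]
  exact (Int.emod_add_mul_ediv (x i) (P : ℤ)).symm

/-- A periodic function factors through the torus: `g x = g (liftTor (toTor P x))`. [folklore] -/
theorem periodic_apply_eq {X : Type*} {g : Site d → X} (hg : ∀ (x : Site d) (τ : Fin d), g (x + (P : ℤ) • e τ) = g x)
    (x : Site d) : g x = g (liftTor (toTor P x)) := by
  obtain ⟨q, hq⟩ := eq_liftTor_toTor_add (P := P) x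
  conv_lhs => rw [hq]
  exact periodic_vec' hg _ q

/-- Sums over the torus are sums over the period box. [folklore] -/
theorem sum_liftTor_eq_sum_periodBox (g : Site d → ℂ) :
    ∑ t : TorSite d P, g (liftTor t) = ∑ x ∈ periodBox (d := d) P, g x := by
  refine Finset.sum_nbij' (fun t => liftTor t) (fun x => toTor P x) (fun t _ => ?_) (fun x _ => Finset.mem_univ _)
    (fun t _ => toTor_liftTor t) (fun x hx => ?_) (fun _ _ => rfl)
  · exact mem_periodBox.mpr fun i => ⟨by simp only [liftTor]; exact_mod_cast Nat.zero_le _,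
      by simp only [liftTor]; exact_mod_cast ZMod.val_lt (t i)⟩
  · have hb := mem_periodBox.mp (Finset.mem_coe.mp hx)
    funext i
    simp only [liftTor, toTor, ZMod.val_intCast]
    exact Int.emod_eq_of_lt (hb i).1 (hb i).2

/-- **THE PERIODIC POISSON EQUATION**: for `P ≥ 1`, a `P`-periodic `f` with zero period sum is the Laplacian of a `P`-periodic `ζ`. [folklore] -/
theorem exists_periodic_lap_eq (f : Site d → ℂ) (hf : ∀ (x : Site d) (τ : Fin d), f (x + (P : ℤ) • e τ) = f x)
    (hf0 : ∑ x ∈ periodBox (d := d) P, f x = 0) :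
    ∃ ζ : Site d → ℂ, (∀ (x : Site d) (τ : Fin d), ζ (x + (P : ℤ) • e τ) = ζ x)
      ∧ ∀ x : Site d, ∑ μ : Fin d, (ζ (x + e μ) - 2 * ζ x + ζ (x - e μ)) = f x := by
  obtain ⟨u, hu⟩ := exists_torLap_eq (d := d) (P := P) (fun t => f (liftTor t))
    (by rw [sum_liftTor_eq_sum_periodBox]; exact hf0)
  refine ⟨fun x => u (toTor P x), fun x τ => by simp only [toTor_add_period], fun x => ?_⟩
  have h := congr_fun hu (toTor P x)
  simp only [torLap, toTor_add_e, toTor_sub_e] at h ⊢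
  rw [h, ← periodic_apply_eq hf]

end Bridge

/-! ## §3 The split -/

section Split

variable {d : ℕ}

/-- The divergence of a coboundary is the Laplacian of the potential. [folklore] -/
theorem div_dPot (ζ : Site d → ℂ) (x : Site d) :
    ∑ κ : Fin d, (dPot ζ x κ - dPot ζ (x - e κ) κ) = ∑ μ : Fin d, (ζ (x + e μ) - 2 * ζ x + ζ (x - e μ)) := by
  refine Finset.sum_congr rfl fun κ _ => ?_
  simp only [dPot, sub_add_cancel]
  ring

/-- The divergence of a periodic form has zero period sum (`P ≥ 1`). [folklore] -/
theorem sum_periodBox_div_eq_zero {P : ℕ} (hP : 1 ≤ P) (Y : Site d → Fin d → ℂ)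
    (hY : ∀ (x : Site d) (τ μ : Fin d), Y (x + (P : ℤ) • e τ) μ = Y x μ) :
    ∑ x ∈ periodBox (d := d) P, ∑ κ : Fin d, (Y x κ - Y (x - e κ) κ) = 0 := by
  rw [Finset.sum_comm]
  refine Finset.sum_eq_zero fun κ _ => ?_
  rw [Finset.sum_sub_distrib, sub_eq_zero]
  have hre := sum_periodBox_add_e hP (g := fun x => (Y (x - e κ) κ).re) (fun x τ => by simp only [add_sub_right_comm, hY]) κ
  have him := sum_periodBox_add_e hP (g := fun x => (Y (x - e κ) κ).im) (fun x τ => by simp only [add_sub_right_comm, hY]) κ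
  simp only [add_sub_cancel_right] at hre him
  apply Complex.ext
  · rw [Complex.re_sum, Complex.re_sum]; exact hre
  · rw [Complex.im_sum, Complex.im_sum]; exact him

/-- **THE FLAT LANDAU∕HODGE SPLIT**: for `P ≥ 1`, every `P`-periodic 1-form `Y` is `η + dPot ζ` with `ζ` `P`-periodic and `η := Y − dPot ζ`
CO-CLOSED at every site. [folklore] -/
theorem exists_flatHodgeSplit {P : ℕ} (hP : 1 ≤ P) (Y : Site d → Fin d → ℂ)
    (hY : ∀ (x : Site d) (τ μ : Fin d), Y (x + (P : ℤ) • e τ) μ = Y x μ) :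
    ∃ ζ : Site d → ℂ, (∀ (x : Site d) (τ : Fin d), ζ (x + (P : ℤ) • e τ) = ζ x)
      ∧ ∀ x : Site d, ∑ κ : Fin d, ((Y x κ - dPot ζ x κ) - (Y (x - e κ) κ - dPot ζ (x - e κ) κ)) = 0 := by
  haveI : NeZero P := ⟨by omega⟩
  obtain ⟨ζ, hζP, hζ⟩ := exists_periodic_lap_eq (d := d) (P := P) (fun x => ∑ κ : Fin d, (Y x κ - Y (x - e κ) κ))
    (fun x τ => by simp only [add_sub_right_comm, hY]) (sum_periodBox_div_eq_zero hP Y hY)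
  refine ⟨ζ, hζP, fun x => ?_⟩
  have h1 : ∑ κ : Fin d, ((Y x κ - dPot ζ x κ) - (Y (x - e κ) κ - dPot ζ (x - e κ) κ))
      = ∑ κ : Fin d, (Y x κ - Y (x - e κ) κ) - ∑ κ : Fin d, (dPot ζ x κ - dPot ζ (x - e κ) κ) := by
    rw [← Finset.sum_sub_distrib]; exact Finset.sum_congr rfl fun _ _ => by ring
  rw [h1, div_dPot, hζ x, sub_self]

/-- The coboundary of a periodic potential is periodic. [folklore] -/
theorem dPot_periodic {P : ℕ} {ζ : Site d → ℂ} (hζ : ∀ (x : Site d) (τ : Fin d), ζ (x + (P : ℤ) • e τ) = ζ x)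
    (x : Site d) (τ μ : Fin d) : dPot ζ (x + (P : ℤ) • e τ) μ = dPot ζ x μ := by
  simp only [dPot, add_right_comm _ ((P : ℤ) • e τ), hζ]

/-- **ORTHOGONALITY**: a periodic co-closed `η` is orthogonal to every periodic coboundary over the period box
(the owner's `sum_inner_dPot_eq_neg_sum_inner_flatDiv` BY NAME). [folklore] -/
theorem sum_inner_dPot_eq_zero_of_coclosed {P : ℕ} (hP : 1 ≤ P) (ξ : Site d → ℂ) (η : Site d → Fin d → ℂ)
    (hξ : ∀ (x : Site d) (τ : Fin d), ξ (x + (P : ℤ) • e τ) = ξ x)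
    (hη : ∀ (x : Site d) (τ μ : Fin d), η (x + (P : ℤ) • e τ) μ = η x μ)
    (hco : ∀ x : Site d, ∑ κ : Fin d, (η x κ - η (x - e κ) κ) = 0) :
    ∑ x ∈ periodBox (d := d) P, ∑ κ : Fin d, ⟪dPot ξ x κ, η x κ⟫_ℝ = 0 := by
  rw [sum_inner_dPot_eq_neg_sum_inner_flatDiv hP ξ η hξ hη]
  simp [hco]

/-- **PYTHAGORAS FOR THE SPLIT**: with `η := Y − dPot ζ` co-closed, `Σ‖Y‖² = Σ‖η‖² + Σ‖dPot ζ‖²` over the period box. [folklore] -/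
theorem sum_norm_sq_eq_of_split {P : ℕ} (hP : 1 ≤ P) (Y : Site d → Fin d → ℂ) (ζ : Site d → ℂ)
    (hY : ∀ (x : Site d) (τ μ : Fin d), Y (x + (P : ℤ) • e τ) μ = Y x μ)
    (hζ : ∀ (x : Site d) (τ : Fin d), ζ (x + (P : ℤ) • e τ) = ζ x)
    (hco : ∀ x : Site d, ∑ κ : Fin d, ((Y x κ - dPot ζ x κ) - (Y (x - e κ) κ - dPot ζ (x - e κ) κ)) = 0) :
    ∑ x ∈ periodBox (d := d) P, ∑ κ : Fin d, ‖Y x κ‖ ^ 2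
      = ∑ x ∈ periodBox (d := d) P, ∑ κ : Fin d, ‖Y x κ - dPot ζ x κ‖ ^ 2
        + ∑ x ∈ periodBox (d := d) P, ∑ κ : Fin d, ‖dPot ζ x κ‖ ^ 2 := by
  have horth := sum_inner_dPot_eq_zero_of_coclosed hP ζ (fun x κ => Y x κ - dPot ζ x κ) hζ
    (fun x τ μ => by simp only [hY, dPot_periodic hζ]) hco
  have hpt : ∀ (x : Site d) (κ : Fin d), ‖Y x κ‖ ^ 2
      = ‖Y x κ - dPot ζ x κ‖ ^ 2 + ‖dPot ζ x κ‖ ^ 2 + 2 * ⟪dPot ζ x κ, Y x κ - dPot ζ x κ⟫_ℝ := by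
    intro x κ
    have h := norm_add_sq_real (Y x κ - dPot ζ x κ) (dPot ζ x κ)
    rw [sub_add_cancel] at h
    rw [h, real_inner_comm]; ring
  simp only [hpt, Finset.sum_add_distrib, ← Finset.mul_sum, horth, mul_zero, add_zero]

end Split

end

end Summit.QuantumFields.BalabanUV.T4Continuum.NE3FlatHodgeSplit
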